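import Summits.QuantumFields.YangMills.Theses.BalabanUVNodes
import Summits.QuantumFields.YangMills.Theorems.BalabanUVNodesN27AtAllPinsOfRecord13CoPHVCutBFreeBareLedgerReadingKernelFaces
import Summits.QuantumFields.YangMills.Theorems.BalabanUVNodesN20OffLiveOneTermReading
import Summits.QuantumFields.YangMills.Theorems.BalabanUVNodesN22AtRecordOfTermDataTableGermsLocatedN18AdmChart
import Summits.QuantumFields.YangMills.Theorems.BalabanUVNodesN18KernelStepRateKingMechanismRecord
import Summits.QuantumFields.YangMills.Theorems.BalabanUVNodesN18AtRecordOfKernelLetters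

/-!
# ★★ LEAF AWBⱽ-1T-K-N22J74 (dag-n27-c g20) — LEAF AWBⱽ-1T-K WITH THE N22 FACE ⟸ dag-n22-c's ROAD 2 AT def-W1's (2.14) TERM DATA, OLDER-TERM SIDE READ ENTIRELY FROM LOCATED RECORDS, AND S25's
# TERM-HOLOMORPHY-THROUGH-THE-CHART ROW DISCHARGED (module J74 `n22At_u3OfRecord₁₃_of_kernelStepRate_termDataTableGermsLocatedN18AdmChartNonexpansive` = J72 with `hEhol` fed by dag-n18-c
# file 32's (GEN) `stepGen_Gn_of_inputs226Holo` on the SAME located record `hloc18`, dag-n18's `hLayer_runTowers_toClusterTower_of_stepGen` and dag-n22-w5's `differentiableOn_E_comp_of_printedSlots`):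
# leaf G20's `hEhol` replaced by the HOLOMORPHIC CHART row `hΦhol : DifferentiableOn ℂ (Φ K k X) (U K k X)` and the space clause in `U`-form (`hΦsp : ∀ z ∈ U K k X, ∀ Z ⊆ X, Φ K k X z ∈ sp K
# (k+1) Z`) — after this leaf the S25 chart block of K3⁸'s N22 bill carries NO analytic statement about the towers (only chart DATA `Ec ι Φ U hU hrU hΦhol hΦemb hΦsp` + site weights).
Cell `pub-ymgap`, HUMAN RULING D-0062 Track A; R134 seat `pub-ymgap-dag-n27-c` (N27 B5 composite, s2), gen 20, trigger (t2⁗); K3⁸ `SpineGivenEndpointR13SepCoPHV` = stmt-QuantumFields-27366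
(skeleton v6 b4e55110ab73e679), `--kind proof --supports 27366 --as helper`; COUNT-NEUTRAL.  ONE theorem, 0 `def`, 0 `sorry`; `N = 2`; guard `ZhUnity ∧ SlotsNondegenerate₁₃`; route-facing.
WHAT IS KERNEL-CHECKED ([bookkeeping]; plug C p650950's proof VERBATIM except the `h22'` line and the swapped rows): ★★★
`spineGivenEndpointR13SepCoPHV_of_liveV5PinsAtCrOfRecord₁₃VAt_cut_bareLedgerReadingV_kernelFaces_n22TermDataTableGermsLocatedN18Adm_offLiveOneTerm_v5pins_bFree` ⊢ **`SpineGivenEndpointR13SepCoPHV` BY NAME**;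
`h22' :=` J72 §2 per guarded admissible tuple (binders VERBATIM under `x ↦ x F θ`, `N ↦ 2`, `θ ↦ θ.toStage13Params`; renames for this file's namespace `g hκ₀ c L a b hL hb hK S D W E₀ Rd ↦ gh
hκh cB LB aB bw hL8 hbw hKb Sm Dz Wn EA Rt`, the records' bound `ι ↦ ιh`; instance binders as instance rows; `TDom terms weight Lemma3Numerics Pot cv univ tdist1 K₀` qualified); `h18' ⟸ h5` as in C.
HONEST FRAMING (binding): COMPOSITE-node bookkeeping BY NAME; a REDUCTION, not a discharge; every displayed row a HYPOTHESIS or a decided MODEL (0∕1 today; K0⁷ OPEN).  Per dag-n22-c ∕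
dag-n18-c ∕ dag-n10-c ∕ node00-def-W1's own framing: the located records `hι` ∕ `hloc18`, def-W1's laws, `SpRestr`, the numerics and the [KP86] clause are DISPLAYED hypothesis SHAPES (GAPS
G-ne9p2-5, G-t4-U3-1∕-3), not printed inequalities; NE9 ∕ NE5 NOT IN PRINT for d = 4; `h5` is node N18's content (King's mechanism, NOT PRINTED for d = 4); sector holomorphy = the cell's
reading of [I] p. 263 ∕ p. 266; `hlinkBareV` = NODE O's world (UNPRINTED, 0 instances); N11 NOT READ; `hβw` = K1's window currency (K1⁹ OPEN); nothing of Bałaban's or King's asserted or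
instantiated; NOT `stub_rates13HV` ∕ `stub_expansion13HV`; N10 ∕ N14–N22 ∕ N27 NOT discharged (the chair books, R417); K3⁸ OPEN, NOT claimed; counts UNMOVED (typed 28∕28 · discharged
5∕27, A 5∕28); one finite four-torus programme at fixed `ε` — NOT ℝ⁴, NOT OS, NOT a mass gap, NOT Clay.  No decl below carries a cite tag.
-/

set_option autoImplicit false

namespace Summit.QuantumFields.YangMills.Theorems.BalabanUVNodesN27SpineRecord
open scoped BigOperators Matrix Matrix.Norms.L2Operator
open Finset MeasureTheory
open Literature.MathematicalPhysics.QuantumFieldTheory.Balaban1983to89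
open T4OutputRate T4RecentScale T4GoodClassBudget T4CauchySum T4TowerRateComposition T4TowerRateDischarge
open T4EtaRateMin (Readings NE3Shape)
open T4RateLiaison (GaugeDominated)
open FlowStep (RGEqH prefixOf)
open TreeLengthTorus (TFaceConnected torusTreeLen)
open B12TreeDecay (kappa₀)
open Summit.QuantumFields.BalabanUV.T4Continuum
open AveragingDeficitDualResidual (dualC1 dualC2)
open AveragingDeficitDerivWallProof (wallConst)
open AveragingDeficitPeriodicCounting (IsPeriodicDir)
open MinimalActionSandwich (IsMinimiser minAct)
open MinimalActionRate (sfClass)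
open MinimalActionRefine (RegularSup gradConst)
open NE3EnergyShapes (IsUnitarySite IsPeriodicSite)
open NE3.LeafIndexSockets (LeafH3sup)
open Summit.QuantumFields.BalabanUV.T4Continuum.Spine
open Summit.QuantumFields.BalabanUV.T4Continuum.Spine.NE4 (runFlow)
open Summit.QuantumFields.BalabanUV.T4Continuum.NE1p.DressedRoot (DressedTower DressedStabilityStrict)
open Summit.QuantumFields.YangMills.BalabanUVNodes.N19LedgerLinkSync (LedgerDataSync LedgerAtSync)
open YMDAG.UVSplit
open Summit.QuantumFields.YangMills.BalabanUVNodes.N16HolderDefs (CovRootHolder N16HolderAt)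
open Summit.QuantumFields.YangMills.BalabanUVNodes.SpineRatesHolder (RatesHolderAt)
open Literature.MathematicalPhysics.QuantumFieldTheory.Balaban1983to89.T4Continuum (T4Family ULoop)
open Node00 (Stage13HParams datumOfRecord₁₃CoPH SiteSeqKey U3Letters₁₁ NE3Letters₁₁ ne3ConstLayerOfRecord₁₁ ne3NperOfRecord₁₁ ne3DomOfRecord₁₁ ZetaMeasurable ppSelLiveOfRecord
  EOfRecord₁₃ wOfRecord₉ localBgMeasurable)
open Literature.MathematicalPhysics.QuantumFieldTheory.Balaban1983to89.B12Sec2to5 (betaPrime510)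
open Literature.MathematicalPhysics.QuantumFieldTheory.Balaban1983to89.Node00.U3OfKernels (objectsOfRecord₁₃ KernelDecayOfRecord₁₃)
open Literature.MathematicalPhysics.QuantumFieldTheory.Balaban1983to89.Node00.U3KernelLetters (GeometricIncrementsOfRecord₁₃ WindowedNE9OfRecord₁₃ WindowedDecayOfRecord₁₃
  WindowedStepRateOfRecord₁₃)
open Summit.QuantumFields.YangMills.BalabanUVNodes.N16PinnedLayer13CoPH (N16PinnedLoose N16LettersEnd rateCarriers_ne3_of_pinnedLoose)
open Summit.QuantumFields.YangMills.BalabanUVNodes.N19TargetClassWeightsE1Keyed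
open YMDAG.N14.TopBorn (Ne1PinnedOfRecord n14At_rateCarriersOfRecord₁₃CoPH_of_pinned)
open Summit.QuantumFields.YangMills.BalabanUVNodes.N15.GenuineRecord (fullGSizedObjects n15At_fullGSizedObjects_family)
open Summit.QuantumFields.YangMills.BalabanUVNodes.N15.AtKeyedHome (neZero_blockFactor)
open T4WeightBudget T4IndicatorShell T4ContinuumYM4Torus T4ApexHybrid
open Summit.QuantumFields.YangMills.Theses.BalabanUVNodes (SpineGivenEndpointR13SepCoPHV)
open NE7 (Target)
open Summit.QuantumFields.YangMills.BalabanUVNodes.N20OffLiveOneTermReading (crOneTerm₁₃ h20_shape_crOneTerm₁₃ h21_shape_crOneTerm₁₃ extraction_crOneTerm₁₃ core_crOneTerm₁₃_iff_target)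
open Literature.MathematicalPhysics.QuantumFieldTheory.Balaban1983to89.Node00 (MatA)
open Literature.MathematicalPhysics.QuantumFieldTheory.Balaban1983to89.Node00.LocalizedSum17 (ReadingMaps Localizes17OfRecord₁₃)
open Literature.MathematicalPhysics.QuantumFieldTheory.Balaban1983to89.Node00.Sect2 (domSys domCount CPair)
open Literature.MathematicalPhysics.QuantumFieldTheory.Balaban1983to89.Node00.W1 (ClusterTower GenTower OlderTerms olderOf recTerm truncRun toClusterTower TermData214 TermLabel RecAdmissible AdmHist SpRestr)
open Literature.MathematicalPhysics.QuantumFieldTheory.Balaban1983to89.Node00.U3OfKernels (histPrefix)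
open Literature.MathematicalPhysics.QuantumFieldTheory.Balaban1983to89.Node00.U3KernelLetters (KernelStepRateOfRecord₁₃ PolLimitsExistOfRecord₁₃)
open Literature.MathematicalPhysics.QuantumFieldTheory.Balaban1983to89.TreeLengthTorus (TPt)
open Literature.MathematicalPhysics.QuantumFieldTheory.Balaban1983to89.B12Decay510 (delta1)
open Literature.MathematicalPhysics.QuantumFieldTheory.Balaban1983to89.B12Decay510Window (K₁)
open Literature.MathematicalPhysics.QuantumFieldTheory.Balaban1983to89.B12Decay510Torus (distCT nearT)
open YMDAG.N22.KernelFading (n22At_u3OfRecord₁₃_of_kernelStepRate_termDataTableGermsLocatedN18AdmChartNonexpansive)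
open YMDAG.N18.KernelStepRateKingMechanism (kernelStepRateOfRecord₁₃_mono)
open YMDAG.N18.AtRecordOfKernelLetters (n18At_u3OfRecord₁₃_objectsOfRecord₁₃_of_kernelStepRateOfRecord₁₃)
variable (K₀ : ℕ) (jc : (F : T4Family) → (θ : Stage13HParams F 2) → θ.Provisos₁₃CoPH F 2 → (ℕ → ℝ) → List (ULoop F) → ℕ → ℕ)
  (sh : ShellSplit₁₃CoPH 2 K₀)
  (β : ℝ) (𝔯 : RateReading₁₃CoPH 2)
  (ℓ : (F : T4Family) → Stage13HParams F 2 → U3Letters₁₁)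
  (ℓ₃ : T4Family → NE3Letters₁₁) (g B c' : T4Family → ℝ)
variable (𝔸 : (F : T4Family) → Stage13HParams F 2 → Type) [∀ (F : T4Family) (θ : Stage13HParams F 2), NormedRing (𝔸 F θ)]
  [∀ (F : T4Family) (θ : Stage13HParams F 2), NormedAlgebra ℂ (𝔸 F θ)] (Ec : (F : T4Family) → Stage13HParams F 2 → ℕ → ℕ → Type*)
  [∀ (F : T4Family) (θ : Stage13HParams F 2) (K k : ℕ), NormedAddCommGroup (Ec F θ K k)] [∀ (F : T4Family) (θ : Stage13HParams F 2) (K k : ℕ), NormedSpace ℂ (Ec F θ K k)]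
  (m' M : (F : T4Family) → Stage13HParams F 2 → ℕ) [hM0 : ∀ (F : T4Family) (θ : Stage13HParams F 2), NeZero (M F θ)]
  (c₀ : (F : T4Family) → Stage13HParams F 2 → B13.Consts) (LB : (F : T4Family) → Stage13HParams F 2 → ℕ) [hL0 : ∀ (F : T4Family) (θ : Stage13HParams F 2), NeZero (LB F θ)]
  (𝔇 : (F : T4Family) → (θ : Stage13HParams F 2) → (K : ℕ) → TermData214 (c₀ F θ) (F.P K) (𝔸 F θ) (M F θ) (LB F θ))
  (emb : (F : T4Family) → (θ : Stage13HParams F 2) → ReadingMaps F (MatA 2) (𝔸 F θ))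
  (sp : (F : T4Family) → (θ : Stage13HParams F 2) → (K j : ℕ) → (domSys (F.P K) (M F θ) j).Dom → Set (CPair (F.P K) (𝔸 F θ)))
  (κ₅ C₅ κ κE δ₀ B₃ r R EA ϱ Mb cw cS Bq r₁ Ck mk aB a₂ a₂' a₅ Aabs bw : (F : T4Family) → Stage13HParams F 2 → ℝ)
  (aw : (F : T4Family) → Stage13HParams F 2 → ℕ → ℕ → ℕ → ℝ)
  (big : (F : T4Family) → (θ : Stage13HParams F 2) → (K j : ℕ) → (domSys (F.P K) (M F θ) j).Dom → Set (CPair (F.P K) (𝔸 F θ)))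
  (Dz : (F : T4Family) → (θ : Stage13HParams F 2) → ℕ → Set ℂ)
  (Sm : (F : T4Family) → (θ : Stage13HParams F 2) → ℕ → ℕ → Type) [∀ (F : T4Family) (θ : Stage13HParams F 2) (K k : ℕ), MeasurableSpace (Sm F θ K k)]
  [∀ (F : T4Family) (θ : Stage13HParams F 2) (K k : ℕ), TopologicalSpace (Sm F θ K k)] [∀ (F : T4Family) (θ : Stage13HParams F 2) (K k : ℕ), OpensMeasurableSpace (Sm F θ K k)]
  (χu : (F : T4Family) → (θ : Stage13HParams F 2) → (K k : ℕ) → (𝔇 F θ K k).UnscaledChi)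
  (χcu : (F : T4Family) → (θ : Stage13HParams F 2) → (K k : ℕ) → (𝔇 F θ K k).UnscaledChi)
  (𝒲 : (F : T4Family) → (θ : Stage13HParams F 2) → (K k : ℕ) → (𝔇 F θ K k).UnscaledWilson)
  (𝒪 : (F : T4Family) → (θ : Stage13HParams F 2) → (K k : ℕ) → (𝔇 F θ K k).UnscaledOlder)
  (Rt : (F : T4Family) → (θ : Stage13HParams F 2) → (K k : ℕ) → (Z : (domSys (F.P K) (M F θ) (k + 1)).Dom) → (t : TermLabel (F.P K) (M F θ) k (LB F θ)) → (𝔇 F θ K k).ReadingAtoms Z t (Sm F θ K k))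
  (Wn : (F : T4Family) → (θ : Stage13HParams F 2) → (K k : ℕ) → (domSys (F.P K) (M F θ) (k + 1)).Dom → TermLabel (F.P K) (M F θ) k (LB F θ) → Set (CPair (F.P K) (𝔸 F θ)))
  (cB : (F : T4Family) → (θ : Stage13HParams F 2) → B13.Consts)
  (O : (F : T4Family) → (θ : Stage13HParams F 2) → ℕ → Set ℂ)
  (V : (F : T4Family) → (θ : Stage13HParams F 2) → (K k : ℕ) → OlderTerms (F.P K) (𝔸 F θ) (M F θ) k → CPair (F.P K) (𝔸 F θ) → (domSys (F.P K) (M F θ) (k + 1)).Dom → ℂ)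
  (ι : (F : T4Family) → (θ : Stage13HParams F 2) →
      (letI := θ.instVβ₁; letI := θ.instVβ₂;
      (K k : ℕ) → (domSys (F.P K) (M F θ) (k + 1)).Dom → ((Fin (F.P K).d → Site (F.P K) (k + 1) → θ.Vβ) →L[ℝ] Ec F θ K k)))
  (Φ : (F : T4Family) → (θ : Stage13HParams F 2) → (K k : ℕ) → (domSys (F.P K) (M F θ) (k + 1)).Dom → Ec F θ K k → CPair (F.P K) (𝔸 F θ))
  (U : (F : T4Family) → (θ : Stage13HParams F 2) → (K k : ℕ) → (domSys (F.P K) (M F θ) (k + 1)).Dom → Set (Ec F θ K k))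
  (w : (F : T4Family) → (θ : Stage13HParams F 2) → (K k : ℕ) → (domSys (F.P K) (M F θ) (k + 1)).Dom → Site (F.P K) (k + 1) → ℝ)

open Classical in
/-- ★★★ **THE ITEM `SpineGivenEndpointR13SepCoPHV` AT EVERY VERSION SLOT — LIVE: ALL PINS, NODE U3 AT THE LIMITING KERNELS OF RECORD WITH THE N22 FACE ⟸ dag-n22-c's ROAD 2 AT
def-W1's TERM DATA, OLDER-TERM SIDE FROM LOCATED RECORDS, CHART EDITION (J74: N18's rate letter `h5` + N10's located record `hι` + N18's located record `hloc18` + tables `big` +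
def-W1's laws + numerics + sector holomorphy + chart DATA with a holomorphic chart `hΦhol` + the STANDING rows; NO analytic row on the towers) AND THE N18 FACE ⟸ `h5`, N19′ AT THE BARE LEDGER READING; OFF-LIVE: ONE (B)-FREE TARGET ROW** (plug C's proof with `h22' :=`
J74 §2).  NOT a discharge; every row a HYPOTHESIS or a decided MODEL; NE9 ∕ NE5 NOT IN PRINT for d = 4; nothing asserted for any family; no node discharged; K3⁸ OPEN. [bookkeeping] -/
theorem spineGivenEndpointR13SepCoPHV_of_liveV5PinsAtCrOfRecord₁₃VAt_cut_bareLedgerReadingV_kernelFaces_n22TermDataTableGermsLocatedN18AdmChart_offLiveOneTerm_v5pins_bFree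
    (ksel : (F : T4Family) → (θ : Stage13HParams F 2) → θ.Provisos₁₃CoPH F 2 → (ℕ → ℝ) → List (ULoop F) → ℕ)
    (hpin1 : Ne1PinnedOfRecord 𝔯)
    (hpin2 : ∃ (b aS : ℝ) (ν μ α β' : Fin 4) (c35 p : ℝ), 0 < b ∧ 0 < aS ∧
      ∀ (F : T4Family) (θ : Stage13HParams F 2) (hP : θ.Provisos₁₃CoPH F 2) (g₀ : ℕ → ℝ) (os : List (ULoop F)) (k : ℕ),
        (𝔯.lit F θ hP g₀ os).ne2 k = haveI := neZero_blockFactor F; fullGSizedObjects 3 F.hL b aS ν μ α β' c35 p)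
    (hpinL : N16PinnedLoose 𝔯 ℓ₃ B)
    (hpin : ∀ (F : T4Family) (θ : Stage13HParams F 2) (hP : θ.Provisos₁₃CoPH F 2) (g₀ : ℕ → ℝ) (os : List (ULoop F)),
      (𝔯.lit F θ hP g₀ os).u3 = objectsOfRecord₁₃ F 2 θ.toStage13Params (ℓ F θ))
    (h16 : ∀ (F : T4Family), (∃ θ : Stage13HParams F 2, θ.Provisos₁₃CoPH F 2 ∧ (θ.ZhUnity F 2 ∧ θ.SlotsNondegenerate₁₃ F 2) ∧ θ.Admissible F 2) →
      N16HolderAt (ne3OfRecord₁₁ F { ne3ConstLayerOfRecord₁₁ F 2 (ℓ₃ F) with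
        dom := {V | V ∈ ne3DomOfRecord₁₁ F 2 0 0 ∧ V ∈ sfClass 4 F.L (ne3NperOfRecord₁₁ F 0 0) ((ℓ₃ F).ε / B F) 0} }) β)
    (hs : ∀ (F : T4Family) (θ : Stage13HParams F 2), θ.Provisos₁₃CoPH F 2 → (θ.ZhUnity F 2 ∧ θ.SlotsNondegenerate₁₃ F 2) → θ.Admissible F 2 → (ℓ F θ).Signs)
    (hκ : ∀ (F : T4Family) (θ : Stage13HParams F 2), θ.Provisos₁₃CoPH F 2 → (θ.ZhUnity F 2 ∧ θ.SlotsNondegenerate₁₃ F 2) → θ.Admissible F 2 → 0 < (ℓ F θ).κ)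
    (hcr : ∀ (F : T4Family) (θ : Stage13HParams F 2), θ.Provisos₁₃CoPH F 2 → (θ.ZhUnity F 2 ∧ θ.SlotsNondegenerate₁₃ F 2) → θ.Admissible F 2 →
      betaPrime510 4 1 (ℓ F θ).κ ≤ (ℓ F θ).cr)
    (hκ₀ : ∀ (F : T4Family) (θ : Stage13HParams F 2), θ.Provisos₁₃CoPH F 2 → (θ.ZhUnity F 2 ∧ θ.SlotsNondegenerate₁₃ F 2) → θ.Admissible F 2 → kappa₀ (4 * 2 ^ 4) (2 * 4) ≤ (ℓ F θ).κ)
    (hK : ∀ (μ ν : Fin 4) (F : T4Family) (θ : Stage13HParams F 2), θ.Provisos₁₃CoPH F 2 → (θ.ZhUnity F 2 ∧ θ.SlotsNondegenerate₁₃ F 2) → θ.Admissible F 2 →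
      KernelDecayOfRecord₁₃ F 2 θ.toStage13Params μ ν (ℓ F θ).κ)
    -- node N18's LIMIT letter at the rate `κ₅` with constant `C₅` (J49's `h5`), keyed to `ℓ F θ` by domination (`hC₅ℓ`, `hℓκ`∕`hκ₅`); (1.21)
    (hlim : ∀ (F : T4Family) (θ : Stage13HParams F 2), θ.Provisos₁₃CoPH F 2 → (θ.ZhUnity F 2 ∧ θ.SlotsNondegenerate₁₃ F 2) → θ.Admissible F 2 → PolLimitsExistOfRecord₁₃ F 2 θ.toStage13Params)
    (h5 : ∀ (F : T4Family) (θ : Stage13HParams F 2), θ.Provisos₁₃CoPH F 2 → (θ.ZhUnity F 2 ∧ θ.SlotsNondegenerate₁₃ F 2) → θ.Admissible F 2 →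
      KernelStepRateOfRecord₁₃ F 2 θ.toStage13Params (κ₅ F θ) (ℓ F θ).θ₅ (C₅ F θ))
    (hC₅ : ∀ (F : T4Family) (θ : Stage13HParams F 2), θ.Provisos₁₃CoPH F 2 → (θ.ZhUnity F 2 ∧ θ.SlotsNondegenerate₁₃ F 2) → θ.Admissible F 2 → 0 ≤ C₅ F θ) (hC₅ℓ : ∀ (F : T4Family) (θ : Stage13HParams F 2), θ.Provisos₁₃CoPH F 2 → (θ.ZhUnity F 2 ∧ θ.SlotsNondegenerate₁₃ F 2) → θ.Admissible F 2 → C₅ F θ ≤ (ℓ F θ).C₅)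
    -- dag-n22-c J74 §2's binders (`…N22AtRecordOfTermDataTableGermsLocatedN18AdmChart`) under `x ↦ x F θ`: leaf G20's rows with S25's term-holomorphy-through-the-chart row `hEhol` GONE (N18 (GEN)
    -- `stepGen_Gn_of_inputs226Holo` on the SAME record `hloc18` ⟹ (2.38) of the run towers ⟹ `hEhol` by dag-n22-w5's `differentiableOn_E_comp_of_printedSlots` inside J74); IN: the HOLOMORPHIC CHART row `hΦhol` and
    -- the space clause in `U`-form `hΦsp : ∀ z ∈ U K k X, ∀ Z ⊆ X, Φ K k X z ∈ sp K (k+1) Z` — the S25 chart block now carries NO analytic statement about the towers, only chart DATA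
    (hM : ∀ (F : T4Family) (θ : Stage13HParams F 2), θ.Provisos₁₃CoPH F 2 → (θ.ZhUnity F 2 ∧ θ.SlotsNondegenerate₁₃ F 2) → θ.Admissible F 2 → M F θ = F.L ^ m' F θ)
    (hloc : ∀ (F : T4Family) (θ : Stage13HParams F 2), θ.Provisos₁₃CoPH F 2 → (θ.ZhUnity F 2 ∧ θ.SlotsNondegenerate₁₃ F 2) → θ.Admissible F 2 → Localizes17OfRecord₁₃ F 2 θ.toStage13Params (fun K => truncRun K (toClusterTower (𝔇 F θ K).Gn)) (emb F θ))
    (hsp : ∀ (F : T4Family) (θ : Stage13HParams F 2), θ.Provisos₁₃CoPH F 2 → (θ.ZhUnity F 2 ∧ θ.SlotsNondegenerate₁₃ F 2) → θ.Admissible F 2 → ∀ (K j : ℕ) (Y : (domSys (F.P K) (M F θ) j).Dom), IsOpen (sp F θ K j Y))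
    (hκh : ∀ (F : T4Family) (θ : Stage13HParams F 2), θ.Provisos₁₃CoPH F 2 → (θ.ZhUnity F 2 ∧ θ.SlotsNondegenerate₁₃ F 2) → θ.Admissible F 2 → kappa₀ (4 * 2 ^ 4) (2 * 4) ≤ κ F θ / 2)
    (hδ₀ : ∀ (F : T4Family) (θ : Stage13HParams F 2), θ.Provisos₁₃CoPH F 2 → (θ.ZhUnity F 2 ∧ θ.SlotsNondegenerate₁₃ F 2) → θ.Admissible F 2 → 0 < δ₀ F θ)
    (hB₃ : ∀ (F : T4Family) (θ : Stage13HParams F 2), θ.Provisos₁₃CoPH F 2 → (θ.ZhUnity F 2 ∧ θ.SlotsNondegenerate₁₃ F 2) → θ.Admissible F 2 → 0 ≤ B₃ F θ)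
    (hr : ∀ (F : T4Family) (θ : Stage13HParams F 2), θ.Provisos₁₃CoPH F 2 → (θ.ZhUnity F 2 ∧ θ.SlotsNondegenerate₁₃ F 2) → θ.Admissible F 2 → 0 < r F θ)
    (hκE : ∀ (F : T4Family) (θ : Stage13HParams F 2), θ.Provisos₁₃CoPH F 2 → (θ.ZhUnity F 2 ∧ θ.SlotsNondegenerate₁₃ F 2) → θ.Admissible F 2 → κ F θ ≤ κE F θ)
    (hκE0 : ∀ (F : T4Family) (θ : Stage13HParams F 2), θ.Provisos₁₃CoPH F 2 → (θ.ZhUnity F 2 ∧ θ.SlotsNondegenerate₁₃ F 2) → θ.Admissible F 2 → 0 ≤ κE F θ)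
    (hE₀ : ∀ (F : T4Family) (θ : Stage13HParams F 2), θ.Provisos₁₃CoPH F 2 → (θ.ZhUnity F 2 ∧ θ.SlotsNondegenerate₁₃ F 2) → θ.Admissible F 2 → 0 ≤ EA F θ)
    (hbigo : ∀ (F : T4Family) (θ : Stage13HParams F 2), θ.Provisos₁₃CoPH F 2 → (θ.ZhUnity F 2 ∧ θ.SlotsNondegenerate₁₃ F 2) → θ.Admissible F 2 → ∀ (K k : ℕ) (Z : (domSys (F.P K) (M F θ) (k + 1)).Dom), IsOpen (big F θ K (k + 1) Z))
    (hrestr : ∀ (F : T4Family) (θ : Stage13HParams F 2), θ.Provisos₁₃CoPH F 2 → (θ.ZhUnity F 2 ∧ θ.SlotsNondegenerate₁₃ F 2) → θ.Admissible F 2 → ∀ (K k : ℕ), SpRestr (sp F θ K (k + 1)))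
    (hbig : ∀ (F : T4Family) (θ : Stage13HParams F 2), θ.Provisos₁₃CoPH F 2 → (θ.ZhUnity F 2 ∧ θ.SlotsNondegenerate₁₃ F 2) → θ.Admissible F 2 → ∀ (K k : ℕ) (Z : (domSys (F.P K) (M F θ) (k + 1)).Dom), sp F θ K (k + 1) Z ⊆ big F θ K (k + 1) Z)
    (hL8 : ∀ (F : T4Family) (θ : Stage13HParams F 2), θ.Provisos₁₃CoPH F 2 → (θ.ZhUnity F 2 ∧ θ.SlotsNondegenerate₁₃ F 2) → θ.Admissible F 2 → 8 ≤ (cB F θ).L)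
    (hLc : ∀ (F : T4Family) (θ : Stage13HParams F 2), θ.Provisos₁₃CoPH F 2 → (θ.ZhUnity F 2 ∧ θ.SlotsNondegenerate₁₃ F 2) → θ.Admissible F 2 → (cB F θ).L = LB F θ)
    (hκ₁ : ∀ (F : T4Family) (θ : Stage13HParams F 2), θ.Provisos₁₃CoPH F 2 → (θ.ZhUnity F 2 ∧ θ.SlotsNondegenerate₁₃ F 2) → θ.Admissible F 2 → 1 ≤ (cB F θ).κ₁)
    (hα₆ : ∀ (F : T4Family) (θ : Stage13HParams F 2), θ.Provisos₁₃CoPH F 2 → (θ.ZhUnity F 2 ∧ θ.SlotsNondegenerate₁₃ F 2) → θ.Admissible F 2 → (cB F θ).α₆ ≠ 0)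
    (hN : ∀ (F : T4Family) (θ : Stage13HParams F 2), θ.Provisos₁₃CoPH F 2 → (θ.ZhUnity F 2 ∧ θ.SlotsNondegenerate₁₃ F 2) → θ.Admissible F 2 → B13Lemma3TorusSocket.Lemma3Numerics (cB F θ) (M F θ) (((cB F θ).L : ℝ) / 2) (aB F θ) (a₂ F θ) (a₂' F θ) (a₅ F θ) (Aabs F θ))
    (hloc18 : ∀ (F : T4Family) (θ : Stage13HParams F 2), θ.Provisos₁₃CoPH F 2 → (θ.ZhUnity F 2 ∧ θ.SlotsNondegenerate₁₃ F 2) → θ.Admissible F 2 → ∀ (K k : ℕ), ∀ s ∈ Dz F θ K, ∀ old : OlderTerms (F.P K) (𝔸 F θ) (M F θ) k,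
      (∀ (j : Fin (k + 1)) (Y : (domSys (F.P K) (M F θ) j).Dom), ∀ ψ ∈ sp F θ K j Y, ‖old j Y ψ‖ ≤ EA F θ * Real.exp (-(r₁ F θ * (domSys (F.P K) (M F θ) j).dj Y))) →
      (∀ (j : Fin (k + 1)) (Y : (domSys (F.P K) (M F θ) j).Dom), AnalyticOnNhd ℂ (old j Y) (sp F θ K j Y)) →
      ∀ (Z : (domSys (F.P K) (M F θ) (k + 1)).Dom), ∀ t ∈ B13Lemma3TorusTerms.terms (LB F θ) (M F θ) Z, ∀ φ₁ ∈ big F θ K (k + 1) Z, ∃ ιh : (𝔇 F θ K k).Inputs226Holo (cB F θ) Z t s old φ₁ (aB F θ) (a₅ F θ),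
        (∀ φ ∈ big F θ K (k + 1) Z, ∀ i j, DifferentiableOn ℂ (fun σ => (𝔇 F θ K k).A Z t φ σ i j) {σ | ∀ j, σ j ∈ ιh.Uσ}) ∧
        (∀ φ ∈ big F θ K (k + 1) Z, ∀ i j, DifferentiableOn ℂ (fun σ => ((𝔇 F θ K k).𝒦 Z t).G2 σ ((𝔇 F θ K k).uOf Z t φ) i j) {σ | ∀ j, σ j ∈ ιh.Uσ}) ∧
        (∀ σ : TPt (F.P K).d (domCount (F.P K) (M F θ) (k + 1)) → ℂ, (∀ j, σ j ∈ ιh.Uσ) → ∀ i j, DifferentiableOn ℂ (fun φ => (𝔇 F θ K k).A Z t φ σ i j) (big F θ K (k + 1) Z)) ∧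
        (∀ σ : TPt (F.P K).d (domCount (F.P K) (M F θ) (k + 1)) → ℂ, (∀ j, σ j ∈ ιh.Uσ) →
          ∀ i j, DifferentiableOn ℂ (fun φ => ((𝔇 F θ K k).𝒦 Z t).G2 σ ((𝔇 F θ K k).uOf Z t φ) i j) (big F θ K (k + 1) Z)) ∧
        (∀ Y B, DifferentiableOn ℂ (fun φ => (𝔇 F θ K k).𝒱 Z t s old φ Y B) (big F θ K (k + 1) Z)) ∧
        (∀ φ ∈ big F θ K (k + 1) Z, ∀ Y, Measurable ((𝔇 F θ K k).𝒱 Z t s old φ Y)) ∧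
        (∀ φ ∈ big F θ K (k + 1) Z, ∀ σ : TPt (F.P K).d (domCount (F.P K) (M F θ) (k + 1)) → ℂ, (∀ j, σ j ∈ ιh.Uσ) → ((𝔇 F θ K k).A Z t φ σ).IsSymm) ∧
        (∀ φ ∈ big F θ K (k + 1) Z, ∀ σ : TPt (F.P K).d (domCount (F.P K) (M F θ) (k + 1)) → ℂ, (∀ j, σ j ∈ ιh.Uσ) → (((𝔇 F θ K k).A Z t φ σ).map Complex.re).PosDef) ∧
        (∀ φ ∈ big F θ K (k + 1) Z, ∀ τ : TreeLengthTorus.TDom (F.P K).d (LB F θ * domCount (F.P K) (M F θ) (k + 1)) → ℂ, (∀ Y, τ Y ∈ ιh.Uτ Y) →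
          ∀ B, ∑ Y ∈ t.1, ‖τ Y‖ * ‖(𝔇 F θ K k).𝒱 Z t s old φ Y B‖ ≤ ιh.a₂₀ / 2 * (B ⬝ᵥ B) + ιh.w) ∧
        (∀ φ ∈ big F θ K (k + 1) Z, ∀ σ : TPt (F.P K).d (domCount (F.P K) (M F θ) (k + 1)) → ℂ, (∀ j, σ j ∈ ιh.Uσ) → ∀ b j, ‖((𝔇 F θ K k).𝒦 Z t).G2 σ ((𝔇 F θ K k).uOf Z t φ) b j‖ ≤
            ιh.KG * Real.exp (-(ιh.kap * B9Thm37GlueTorus.tdist1 (𝔇 F θ K k).Nf (((𝔇 F θ K k).𝒦 Z t).locΛ b) (((𝔇 F θ K k).𝒦 Z t).locN j)))) ∧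
        (∀ φ ∈ big F θ K (k + 1) Z, ∀ σ : TPt (F.P K).d (domCount (F.P K) (M F θ) (k + 1)) → ℂ, (∀ j, σ j ∈ ιh.Uσ) → ∀ b b', ‖((𝔇 F θ K k).A Z t φ σ)⁻¹ b b'‖ ≤
            ιh.KCs * Real.exp (-(ιh.kap * B9Thm37GlueTorus.tdist1 (𝔇 F θ K k).Nf (((𝔇 F θ K k).𝒦 Z t).locΛ b) (((𝔇 F θ K k).𝒦 Z t).locΛ b')))) ∧
        (∀ φ ∈ big F θ K (k + 1) Z, ∀ σ : TPt (F.P K).d (domCount (F.P K) (M F θ) (k + 1)) → ℂ, (∀ j, σ j ∈ ιh.Uσ) →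
          ∀ b j, ‖(((𝔇 F θ K k).𝒦 Z t).G2 σ ((𝔇 F θ K k).uOf Z t φ) - ((𝔇 F θ K k).𝒦 Z t).Γ₀.map (algebraMap ℝ ℂ)) b j‖ ≤
            ιh.θΓ * Real.exp (-(ιh.kap * B9Thm37GlueTorus.tdist1 (𝔇 F θ K k).Nf (((𝔇 F θ K k).𝒦 Z t).locΛ b) (((𝔇 F θ K k).𝒦 Z t).locN j)))) ∧
        (∀ φ ∈ big F θ K (k + 1) Z, ∀ σ : TPt (F.P K).d (domCount (F.P K) (M F θ) (k + 1)) → ℂ, (∀ j, σ j ∈ ιh.Uσ) →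
          ∀ b b', ‖(((𝔇 F θ K k).A Z t φ σ)⁻¹ - ((𝔇 F θ K k).𝒦 Z t).C.map (algebraMap ℝ ℂ)) b b'‖ ≤
            ιh.θC * Real.exp (-(ιh.kap * B9Thm37GlueTorus.tdist1 (𝔇 F θ K k).Nf (((𝔇 F θ K k).𝒦 Z t).locΛ b) (((𝔇 F θ K k).𝒦 Z t).locΛ b')))) ∧
        (∀ φ ∈ big F θ K (k + 1) Z, ∀ σ : TPt (F.P K).d (domCount (F.P K) (M F θ) (k + 1)) → ℂ, (∀ j, σ j ∈ ιh.Uσ) →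
          ∀ b b', ‖((𝔇 F θ K k).A Z t φ σ - ((𝔇 F θ K k).𝒦 Z t).C⁻¹.map (algebraMap ℝ ℂ)) b b'‖ ≤
            ιh.θE * Real.exp (-(ιh.kap * B9Thm37GlueTorus.tdist1 (𝔇 F θ K k).Nf (((𝔇 F θ K k).𝒦 Z t).locΛ b) (((𝔇 F θ K k).𝒦 Z t).locΛ b')))))
    (hD : ∀ (F : T4Family) (θ : Stage13HParams F 2), θ.Provisos₁₃CoPH F 2 → (θ.ZhUnity F 2 ∧ θ.SlotsNondegenerate₁₃ F 2) → θ.Admissible F 2 → ∀ K, ∀ t ∈ Set.Ioc (0 : ℝ) θ.γ, ((t : ℝ) : ℂ) ∈ Dz F θ K)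
    (hlaw : ∀ (F : T4Family) (θ : Stage13HParams F 2), θ.Provisos₁₃CoPH F 2 → (θ.ZhUnity F 2 ∧ θ.SlotsNondegenerate₁₃ F 2) → θ.Admissible F 2 → ∀ K, (𝔇 F θ K).UnscaledFieldLawOn (χu F θ K) (χcu F θ K) (𝒲 F θ K) (𝒪 F θ K) θ.γ)
    (hread : ∀ (F : T4Family) (θ : Stage13HParams F 2), θ.Provisos₁₃CoPH F 2 → (θ.ZhUnity F 2 ∧ θ.SlotsNondegenerate₁₃ F 2) → θ.Admissible F 2 → ∀ K k, (𝔇 F θ K k).ReadsBy (𝒪 F θ K k) (Rt F θ K k))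
    (hmaps : ∀ (F : T4Family) (θ : Stage13HParams F 2), θ.Provisos₁₃CoPH F 2 → (θ.ZhUnity F 2 ∧ θ.SlotsNondegenerate₁₃ F 2) → θ.Admissible F 2 → ∀ (K k : ℕ) (Z : (domSys (F.P K) (M F θ) (k + 1)).Dom) (t : TermLabel (F.P K) (M F θ) k (LB F θ)), (Rt F θ K k Z t).MapsToTables (sp F θ K) (Wn F θ K k Z t) Set.univ)
    (hW : ∀ (F : T4Family) (θ : Stage13HParams F 2), θ.Provisos₁₃CoPH F 2 → (θ.ZhUnity F 2 ∧ θ.SlotsNondegenerate₁₃ F 2) → θ.Admissible F 2 → ∀ (K k : ℕ) (X Z : (domSys (F.P K) (M F θ) (k + 1)).Dom), Subtype.val Z ⊆ Subtype.val X → ∀ s ∈ B13Lemma3TorusTerms.terms (LB F θ) (M F θ) Z, sp F θ K (k + 1) X ⊆ Wn F θ K k Z s)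
    (hcont : ∀ (F : T4Family) (θ : Stage13HParams F 2), θ.Provisos₁₃CoPH F 2 → (θ.ZhUnity F 2 ∧ θ.SlotsNondegenerate₁₃ F 2) → θ.Admissible F 2 → ∀ (K k : ℕ) (Z : (domSys (F.P K) (M F θ) (k + 1)).Dom) (t : TermLabel (F.P K) (M F θ) k (LB F θ)), (Rt F θ K k Z t).CfgContinuous)
    (hjc : ∀ (F : T4Family) (θ : Stage13HParams F 2), θ.Provisos₁₃CoPH F 2 → (θ.ZhUnity F 2 ∧ θ.SlotsNondegenerate₁₃ F 2) → θ.Admissible F 2 → ∀ (K k : ℕ) (Z : (domSys (F.P K) (M F θ) (k + 1)).Dom) (t : TermLabel (F.P K) (M F θ) k (LB F θ)), (Rt F θ K k Z t).CfgJointContinuous)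
    (hKb : ∀ (F : T4Family) (θ : Stage13HParams F 2), θ.Provisos₁₃CoPH F 2 → (θ.ZhUnity F 2 ∧ θ.SlotsNondegenerate₁₃ F 2) → θ.Admissible F 2 → ∀ (K k : ℕ) (Z : (domSys (F.P K) (M F θ) (k + 1)).Dom) (t : TermLabel (F.P K) (M F θ) k (LB F θ)), (Rt F θ K k Z t).KernelBounded (Ck F θ))
    (hμ : ∀ (F : T4Family) (θ : Stage13HParams F 2), θ.Provisos₁₃CoPH F 2 → (θ.ZhUnity F 2 ∧ θ.SlotsNondegenerate₁₃ F 2) → θ.Admissible F 2 → ∀ (K k : ℕ) (Z : (domSys (F.P K) (M F θ) (k + 1)).Dom) (t : TermLabel (F.P K) (M F θ) k (LB F θ)), (Rt F θ K k Z t).FiniteMass (mk F θ))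
    (hCk : ∀ (F : T4Family) (θ : Stage13HParams F 2), θ.Provisos₁₃CoPH F 2 → (θ.ZhUnity F 2 ∧ θ.SlotsNondegenerate₁₃ F 2) → θ.Admissible F 2 → 0 ≤ Ck F θ)
    (hmk : ∀ (F : T4Family) (θ : Stage13HParams F 2), θ.Provisos₁₃CoPH F 2 → (θ.ZhUnity F 2 ∧ θ.SlotsNondegenerate₁₃ F 2) → θ.Admissible F 2 → 0 ≤ mk F θ)
    (hWm : ∀ (F : T4Family) (θ : Stage13HParams F 2), θ.Provisos₁₃CoPH F 2 → (θ.ZhUnity F 2 ∧ θ.SlotsNondegenerate₁₃ F 2) → θ.Admissible F 2 →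
      ∀ (K k : ℕ) (Z : (domSys (F.P K) (M F θ) (k + 1)).Dom) (t : TermLabel (F.P K) (M F θ) k (LB F θ)) (φ : CPair (F.P K) (𝔸 F θ)) (Y : TreeLengthTorus.TDom (F.P K).d (LB F θ * domCount (F.P K) (M F θ) (k + 1))),
      Measurable fun B : ((𝔇 F θ K k).𝒦 Z t).Λ → ℝ => 𝒲 F θ K k Z t φ Y B)
    (hbw : ∀ (F : T4Family) (θ : Stage13HParams F 2), θ.Provisos₁₃CoPH F 2 → (θ.ZhUnity F 2 ∧ θ.SlotsNondegenerate₁₃ F 2) → θ.Admissible F 2 → 0 < bw F θ)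
    (hbaw : ∀ (F : T4Family) (θ : Stage13HParams F 2), θ.Provisos₁₃CoPH F 2 → (θ.ZhUnity F 2 ∧ θ.SlotsNondegenerate₁₃ F 2) → θ.Admissible F 2 → ∀ K k j, bw F θ ≤ aw F θ K k j)
    (hι : ∀ (F : T4Family) (θ : Stage13HParams F 2), θ.Provisos₁₃CoPH F 2 → (θ.ZhUnity F 2 ∧ θ.SlotsNondegenerate₁₃ F 2) → θ.Admissible F 2 → ∀ (K k : ℕ), ∀ t ∈ Set.Ioc (0 : ℝ) θ.γ, ∀ (X : (domSys (F.P K) (M F θ) (k + 1)).Dom), ∀ φ ∈ sp F θ K (k + 1) X,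
      ∀ Z : (domSys (F.P K) (M F θ) (k + 1)).Dom, Subtype.val Z ⊆ Subtype.val X → ∀ s ∈ B13Lemma3TorusTerms.terms (LB F θ) (M F θ) Z,
        ∃ old₀ ∈ AdmHist (sp F θ K) (EA F θ) (r₁ F θ) k, ∃ ιh : (𝔇 F θ K k).Inputs226Holo (cB F θ) Z s ((t : ℝ) : ℂ) old₀ φ (aB F θ) (a₅ F θ), ∃ τs w₀ : ℝ,
          (∀ τ : TreeLengthTorus.TDom (F.P K).d (LB F θ * domCount (F.P K) (M F θ) (k + 1)) → ℂ, (∀ Y, τ Y ∈ ιh.Uτ Y) → ∑ Y ∈ s.1, ‖τ Y‖ ≤ τs) ∧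
          (∀ τ : TreeLengthTorus.TDom (F.P K).d (LB F θ * domCount (F.P K) (M F θ) (k + 1)) → ℂ, (∀ Y, τ Y ∈ ιh.Uτ Y) → ∀ B : ((𝔇 F θ K k).𝒦 Z s).Λ → ℝ,
            ∑ Y ∈ s.1, ‖τ Y‖ * ‖(𝔇 F θ K k).𝒱 Z s ((t : ℝ) : ℂ) old₀ φ Y B‖ ≤ ιh.a₂₀ / 2 * (B ⬝ᵥ B) + w₀) ∧
          w₀ + τs * ((∑ _j : Fin (k + 1), ∑ _X : (domSys (F.P K) (M F θ) _j).Dom, Ck F θ) * mk F θ * (EA F θ + (bw F θ)⁻¹ * R F θ)) ≤ ιh.w)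
    (hA0 : ∀ (F : T4Family) (θ : Stage13HParams F 2), θ.Provisos₁₃CoPH F 2 → (θ.ZhUnity F 2 ∧ θ.SlotsNondegenerate₁₃ F 2) → θ.Admissible F 2 → 0 ≤ (cB F θ).C3act * (cB F θ).ε₁)
    (hr₁ : ∀ (F : T4Family) (θ : Stage13HParams F 2), θ.Provisos₁₃CoPH F 2 → (θ.ZhUnity F 2 ∧ θ.SlotsNondegenerate₁₃ F 2) → θ.Admissible F 2 → 0 ≤ r₁ F θ)
    (hrate : ∀ (F : T4Family) (θ : Stage13HParams F 2), θ.Provisos₁₃CoPH F 2 → (θ.ZhUnity F 2 ∧ θ.SlotsNondegenerate₁₃ F 2) → θ.Admissible F 2 → r₁ F θ + 2 * (64 * Real.log 162) + 2 ≤ (1 - 8 * (cB F θ).δ) * (((cB F θ).L : ℝ) / 2) * (cB F θ).κ)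
    (hKP : ∀ (F : T4Family) (θ : Stage13HParams F 2), θ.Provisos₁₃CoPH F 2 → (θ.ZhUnity F 2 ∧ θ.SlotsNondegenerate₁₃ F 2) → θ.Admissible F 2 → (cB F θ).C3act * (cB F θ).ε₁ * Real.exp (5 * r₁ F θ + 1) * B12TreeDecay.K₀ 64 8 * 9 * 64 < 1)
    (hκr : ∀ (F : T4Family) (θ : Stage13HParams F 2), θ.Provisos₁₃CoPH F 2 → (θ.ZhUnity F 2 ∧ θ.SlotsNondegenerate₁₃ F 2) → θ.Admissible F 2 → κE F θ ≤ r₁ F θ)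
    (hrenew : ∀ (F : T4Family) (θ : Stage13HParams F 2), θ.Provisos₁₃CoPH F 2 → (θ.ZhUnity F 2 ∧ θ.SlotsNondegenerate₁₃ F 2) → θ.Admissible F 2 → Real.exp 1 * 9 * 64 * B12TreeDecay.K₀ 64 8 ^ 2 * ((cB F θ).C3act * (cB F θ).ε₁) ≤ Mb F θ)
    (hrenewE : ∀ (F : T4Family) (θ : Stage13HParams F 2), θ.Provisos₁₃CoPH F 2 → (θ.ZhUnity F 2 ∧ θ.SlotsNondegenerate₁₃ F 2) → θ.Admissible F 2 → Real.exp 1 * 9 * 64 * B12TreeDecay.K₀ 64 8 ^ 2 * ((cB F θ).C3act * (cB F θ).ε₁) ≤ EA F θ)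
    (hawcw : ∀ (F : T4Family) (θ : Stage13HParams F 2), θ.Provisos₁₃CoPH F 2 → (θ.ZhUnity F 2 ∧ θ.SlotsNondegenerate₁₃ F 2) → θ.Admissible F 2 → ∀ K k j, aw F θ K k j ≤ cw F θ)
    (hC1 : ∀ (F : T4Family) (θ : Stage13HParams F 2), θ.Provisos₁₃CoPH F 2 → (θ.ZhUnity F 2 ∧ θ.SlotsNondegenerate₁₃ F 2) → θ.Admissible F 2 → 4 * Mb F θ * cw F θ / ϱ F θ < 1)
    (hMb0 : ∀ (F : T4Family) (θ : Stage13HParams F 2), θ.Provisos₁₃CoPH F 2 → (θ.ZhUnity F 2 ∧ θ.SlotsNondegenerate₁₃ F 2) → θ.Admissible F 2 → 0 ≤ Mb F θ)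
    (hϱ : ∀ (F : T4Family) (θ : Stage13HParams F 2), θ.Provisos₁₃CoPH F 2 → (θ.ZhUnity F 2 ∧ θ.SlotsNondegenerate₁₃ F 2) → θ.Admissible F 2 → 0 < ϱ F θ)
    (hR : ∀ (F : T4Family) (θ : Stage13HParams F 2), θ.Provisos₁₃CoPH F 2 → (θ.ZhUnity F 2 ∧ θ.SlotsNondegenerate₁₃ F 2) → θ.Admissible F 2 → cw F θ * EA F θ + ϱ F θ < R F θ)
    (hcS : ∀ (F : T4Family) (θ : Stage13HParams F 2), θ.Provisos₁₃CoPH F 2 → (θ.ZhUnity F 2 ∧ θ.SlotsNondegenerate₁₃ F 2) → θ.Admissible F 2 → 0 < cS F θ)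
    (hBq : ∀ (F : T4Family) (θ : Stage13HParams F 2), θ.Provisos₁₃CoPH F 2 → (θ.ZhUnity F 2 ∧ θ.SlotsNondegenerate₁₃ F 2) → θ.Admissible F 2 → 0 ≤ Bq F θ)
    (hballS : ∀ (F : T4Family) (θ : Stage13HParams F 2), θ.Provisos₁₃CoPH F 2 → (θ.ZhUnity F 2 ∧ θ.SlotsNondegenerate₁₃ F 2) → θ.Admissible F 2 → ∀ K, ∀ s ∈ Set.Ioc (0 : ℝ) θ.γ, Metric.closedBall (s : ℂ) (cS F θ * s) ⊆ O F θ K)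
    (hholS : ∀ (F : T4Family) (θ : Stage13HParams F 2), θ.Provisos₁₃CoPH F 2 → (θ.ZhUnity F 2 ∧ θ.SlotsNondegenerate₁₃ F 2) → θ.Admissible F 2 →
      ∀ (K k : ℕ) (old : OlderTerms (F.P K) (𝔸 F θ) (M F θ) k), old ∈ AdmHist (sp F θ K) (EA F θ) (r₁ F θ) k ∧ old 0 = 0 → ∀ (X : (domSys (F.P K) (M F θ) (k + 1)).Dom), ∀ φ ∈ sp F θ K (k + 1) X,
      DifferentiableOn ℂ (fun z => ((𝔇 F θ K).Gn k).E z old φ X) (O F θ K))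
    (hbdS : ∀ (F : T4Family) (θ : Stage13HParams F 2), θ.Provisos₁₃CoPH F 2 → (θ.ZhUnity F 2 ∧ θ.SlotsNondegenerate₁₃ F 2) → θ.Admissible F 2 →
      ∀ (K k : ℕ) (old : OlderTerms (F.P K) (𝔸 F θ) (M F θ) k), old ∈ AdmHist (sp F θ K) (EA F θ) (r₁ F θ) k ∧ old 0 = 0 → ∀ (X : (domSys (F.P K) (M F θ) (k + 1)).Dom), ∀ φ ∈ sp F θ K (k + 1) X,
      ∀ s ∈ Set.Ioc (0 : ℝ) θ.γ, ∀ z ∈ Metric.closedBall (s : ℂ) (cS F θ * s),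
        ‖((𝔇 F θ K).Gn k).E z old φ X - V F θ K k old φ X‖ ≤ Bq F θ * Real.exp (-(κE F θ * (domSys (F.P K) (M F θ) (k + 1)).dj X)) * s ^ 2)
    (hU : ∀ (F : T4Family) (θ : Stage13HParams F 2), θ.Provisos₁₃CoPH F 2 → (θ.ZhUnity F 2 ∧ θ.SlotsNondegenerate₁₃ F 2) → θ.Admissible F 2 → ∀ K k X, IsOpen (U F θ K k X))
    (hrU : ∀ (F : T4Family) (θ : Stage13HParams F 2), θ.Provisos₁₃CoPH F 2 → (θ.ZhUnity F 2 ∧ θ.SlotsNondegenerate₁₃ F 2) → θ.Admissible F 2 → ∀ K k X, Metric.ball (0 : Ec F θ K k) (r F θ) ⊆ U F θ K k X)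
    (hΦhol : ∀ (F : T4Family) (θ : Stage13HParams F 2), θ.Provisos₁₃CoPH F 2 → (θ.ZhUnity F 2 ∧ θ.SlotsNondegenerate₁₃ F 2) → θ.Admissible F 2 → ∀ (K k : ℕ) (X : (domSys (F.P K) (M F θ) (k + 1)).Dom), DifferentiableOn ℂ (Φ F θ K k X) (U F θ K k X))
    (hΦemb : ∀ (F : T4Family) (θ : Stage13HParams F 2), θ.Provisos₁₃CoPH F 2 → (θ.ZhUnity F 2 ∧ θ.SlotsNondegenerate₁₃ F 2) → θ.Admissible F 2 →
      (letI := θ.instVβ₁; letI := θ.instVβ₂;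
      ∀ (K k : ℕ) (X : (domSys (F.P K) (M F θ) (k + 1)).Dom) (Bf : Fin (F.P K).d → Site (F.P K) (k + 1) → θ.Vβ),
        Φ F θ K k X (ι F θ K k X Bf) = emb F θ K k (fun l t => NormedSpace.exp (θ.ρ8 (Bf l t)))))
    (hΦsp : ∀ (F : T4Family) (θ : Stage13HParams F 2), θ.Provisos₁₃CoPH F 2 → (θ.ZhUnity F 2 ∧ θ.SlotsNondegenerate₁₃ F 2) → θ.Admissible F 2 → ∀ (K k : ℕ) (X : (domSys (F.P K) (M F θ) (k + 1)).Dom), ∀ z ∈ U F θ K k X, ∀ Z : (domSys (F.P K) (M F θ) (k + 1)).Dom, Z.1 ⊆ X.1 → Φ F θ K k X z ∈ sp F θ K (k + 1) Z)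
    (hw₀ : ∀ (F : T4Family) (θ : Stage13HParams F 2), θ.Provisos₁₃CoPH F 2 → (θ.ZhUnity F 2 ∧ θ.SlotsNondegenerate₁₃ F 2) → θ.Admissible F 2 → ∀ K k X t, 0 ≤ w F θ K k X t)
    (hw : ∀ (F : T4Family) (θ : Stage13HParams F 2), θ.Provisos₁₃CoPH F 2 → (θ.ZhUnity F 2 ∧ θ.SlotsNondegenerate₁₃ F 2) → θ.Admissible F 2 →
      (letI := θ.instVβ₁; letI := θ.instVβ₂; letI := θ.instιβ;
      ∀ (K k : ℕ) (X : (domSys (F.P K) (M F θ) (k + 1)).Dom) (l : Fin (F.P K).d) (t : Site (F.P K) (k + 1)) (cι : θ.ιβ),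
        ‖ι F θ K k X (Pi.single l (Pi.single t (θ.bV cι)))‖ ≤ w F θ K k X t))
    (htail : ∀ (F : T4Family) (θ : Stage13HParams F 2), θ.Provisos₁₃CoPH F 2 → (θ.ZhUnity F 2 ∧ θ.SlotsNondegenerate₁₃ F 2) → θ.Admissible F 2 →
      ∀ (K k : ℕ) (X : (domSys (F.P K) (M F θ) (k + 1)).Dom) (t : Site (F.P K) (k + 1)),
        let e : Site (F.P K) (k + 1) → TPt 4 (domCount (F.P K) (M F θ) (k + 1) * M F θ) := fun x i => (ZMod.cast (x i) : ZMod (domCount (F.P K) (M F θ) (k + 1) * M F θ));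
        w F θ K k X t ≤ B₃ F θ * Real.exp (-δ₀ F θ * distCT (domCount (F.P K) (M F θ) (k + 1)) (M F θ) (e t) (nearT (M := M F θ) (e t) X)))
    (hκ₅ : ∀ (F : T4Family) (θ : Stage13HParams F 2), θ.Provisos₁₃CoPH F 2 → (θ.ZhUnity F 2 ∧ θ.SlotsNondegenerate₁₃ F 2) → θ.Admissible F 2 → delta1 (δ₀ F θ) (κ F θ) ((M F θ : ℝ) * 4) ≤ κ₅ F θ)
    (hω : ∀ (F : T4Family) (θ : Stage13HParams F 2), θ.Provisos₁₃CoPH F 2 → (θ.ZhUnity F 2 ∧ θ.SlotsNondegenerate₁₃ F 2) → θ.Admissible F 2 → 0 < (ℓ F θ).ω)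
    (hθω : ∀ (F : T4Family) (θ : Stage13HParams F 2), θ.Provisos₁₃CoPH F 2 → (θ.ZhUnity F 2 ∧ θ.SlotsNondegenerate₁₃ F 2) → θ.Admissible F 2 → (ℓ F θ).θ₅ ≤ (ℓ F θ).ω ^ 2)
    (hℓκ : ∀ (F : T4Family) (θ : Stage13HParams F 2), θ.Provisos₁₃CoPH F 2 → (θ.ZhUnity F 2 ∧ θ.SlotsNondegenerate₁₃ F 2) → θ.Admissible F 2 → (ℓ F θ).κ ≤ delta1 (δ₀ F θ) (κ F θ) ((M F θ : ℝ) * 4))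
    (hC₉ : ∀ (F : T4Family) (θ : Stage13HParams F 2), θ.Provisos₁₃CoPH F 2 → (θ.ZhUnity F 2 ∧ θ.SlotsNondegenerate₁₃ F 2) → θ.Admissible F 2 →
      (4 * (2 * C₅ F θ / (1 - (ℓ F θ).θ₅) + 2 * ((16 * Mb F θ * B₃ F θ ^ 2 / r F θ ^ 2) * Real.exp (delta1 (δ₀ F θ) (κ F θ) ((M F θ : ℝ) * 4) * ((M F θ : ℝ) * 4) * 3) * B12TreeDecay.K₀ (4 * 2 ^ 4) (2 * 4) * K₁ 4 (δ₀ F θ / 2))) / θ.γ +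
      ((16 * max ((6 * cS F θ ^ 2 + 32 * cS F θ + 64) / cS F θ ^ 2 * Bq F θ) (64 * Mb F θ * cw F θ ^ 2 / ϱ F θ ^ 2 * (Bq F θ * θ.γ / cS F θ) ^ 2 / (1 - 4 * Mb F θ * cw F θ / ϱ F θ)) * B₃ F θ ^ 2 / r F θ ^ 2) * Real.exp (delta1 (δ₀ F θ) (κ F θ) ((M F θ : ℝ) * 4) * ((M F θ : ℝ) * 4) * 3) * B12TreeDecay.K₀ (4 * 2 ^ 4) (2 * 4) *
        K₁ 4 (δ₀ F θ / 2)) * θ.γ / 2) / (ℓ F θ).ω ≤ (ℓ F θ).C₉)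
    (hβ23 : 2 / 3 < β) (hβ1 : β ≤ 1)
    (hmatch : ∀ F : T4Family, 0 < B F ∧ (ℓ₃ F).ε / B F ≤ (ℓ₃ F).b)
    (hend : N16LettersEnd 2 g ℓ₃)
    (hradii : ∀ F : T4Family, (ℓ₃ F).g = gradConst 4 (c' F) ∧ 0 ≤ c' F ∧ 0 < c' F ∧ (ℓ₃ F).b ≤ c' F ∧
      (2 : ℝ) ^ 91 * (F.L : ℝ) ^ 17 * c' F ≤ 1 ∧ (2 : ℝ) ^ 76 * (F.L : ℝ) ^ 12 * c' F ≤ (ℓ₃ F).ε ∧ (ℓ₃ F).ε / B F ≤ 1 / 4 ∧ 4 * ((ℓ₃ F).ε / B F) ≤ c' F)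
    (hclass : ∀ F : T4Family, 16 * B7Prop2Explicit.C0 4 * (ℓ₃ F).ε ≤ 3 ∧ 1024 * (4 + 1) * (4 + 4) * (F.L : ℝ) ^ 2 * (ℓ₃ F).ε ≤ 1)
    (hH3 : ∀ (F : T4Family) (θ : Stage13HParams F 2) (hP : θ.Provisos₁₃CoPH F 2) (g₀ : ℕ → ℝ) (os : List (ULoop F)) (k : ℕ),
      LeafH3sup 4 (rateCarriersOfRecord₁₃CoPH 𝔯 F θ hP g₀ os k).ne3.L (rateCarriersOfRecord₁₃CoPH 𝔯 F θ hP g₀ os k).ne3.Nper (rateCarriersOfRecord₁₃CoPH 𝔯 F θ hP g₀ os k).ne3.ε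
        (rateCarriersOfRecord₁₃CoPH 𝔯 F θ hP g₀ os k).ne3.b (c' F) (rateCarriersOfRecord₁₃CoPH 𝔯 F θ hP g₀ os k).ne3.dom)
    (hsel3 : ∀ (F : T4Family) (θ : Stage13HParams F 2) (hP : θ.Provisos₁₃CoPH F 2) (g₀ : ℕ → ℝ) (os : List (ULoop F)) (k : ℕ),
      ∃ sel : ℕ → (B7Prop1Explicit.Site 4 → Fin 4 → (Matrix (Fin 2) (Fin 2) ℂ)ˣ) → (B7Prop1Explicit.Site 4 → Fin 4 → (Matrix (Fin 2) (Fin 2) ℂ)ˣ),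
        (∀ V ∈ (rateCarriersOfRecord₁₃CoPH 𝔯 F θ hP g₀ os k).ne3.dom, ∀ j : ℕ,
          IsMinimiser 4 (sfClass 4 (rateCarriersOfRecord₁₃CoPH 𝔯 F θ hP g₀ os k).ne3.L (rateCarriersOfRecord₁₃CoPH 𝔯 F θ hP g₀ os k).ne3.Nper (rateCarriersOfRecord₁₃CoPH 𝔯 F θ hP g₀ os k).ne3.ε)
            (rateCarriersOfRecord₁₃CoPH 𝔯 F θ hP g₀ os k).ne3.L (rateCarriersOfRecord₁₃CoPH 𝔯 F θ hP g₀ os k).ne3.Nper j V (sel j V)) ∧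
        (∀ V ∈ (rateCarriersOfRecord₁₃CoPH 𝔯 F θ hP g₀ os k).ne3.dom, ∀ j : ℕ,
          RegularSup 4 (rateCarriersOfRecord₁₃CoPH 𝔯 F θ hP g₀ os k).ne3.L (rateCarriersOfRecord₁₃CoPH 𝔯 F θ hP g₀ os k).ne3.Nper (rateCarriersOfRecord₁₃CoPH 𝔯 F θ hP g₀ os k).ne3.b (c' F) j (sel j V)))
    (hβw : ∀ (F : T4Family) (θ : Stage13HParams F 2) (hP : θ.Provisos₁₃CoPH F 2), (θ.ZhUnity F 2 ∧ θ.SlotsNondegenerate₁₃ F 2) → θ.Admissible F 2 →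
      ∃ γ₀ b b' : ℝ, 0 < γ₀ ∧ 0 < b ∧ DagBinding.BetaBoundsInInterval (datumOfRecord₁₃CoPH F 2 θ hP).C.toB12 γ₀ b b')
    (hζm : ∀ (F : T4Family) (θ : Stage13HParams F 2), θ.Provisos₁₃CoPH F 2 → ((θ.ZhUnity F 2 ∧ θ.SlotsNondegenerate₁₃ F 2) ∧ θ.ppSel = ppSelLiveOfRecord F 2 θ.ν θ.τ9 (EOfRecord₁₃ F 2 θ.toStage13Params) (wOfRecord₉ F 2 θ.toStage9Params)) → θ.Admissible F 2 →
      ZetaMeasurable F 2 θ.ζ)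
    (h20 : ∀ (F : T4Family) (θ : Stage13HParams F 2) (hP : θ.Provisos₁₃CoPH F 2), ((θ.ZhUnity F 2 ∧ θ.SlotsNondegenerate₁₃ F 2) ∧ θ.ppSel = ppSelLiveOfRecord F 2 θ.ν θ.τ9 (EOfRecord₁₃ F 2 θ.toStage13Params) (wOfRecord₉ F 2 θ.toStage9Params)) → θ.Admissible F 2 →
      ∀ (g₀ : ℕ → ℝ) (os : List (ULoop F)),
        ∃ W : ℕ → ℝ, RelWeightBound 1 (classSet₁₃ θ K₀ g₀) (weightA₁₃ θ hP K₀ g₀ os) (weightB₁₃ θ hP K₀ g₀ os) (badClass₁₃ θ K₀ g₀ (jc F θ hP g₀ os)) W)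
    (h21 : ∀ (F : T4Family) (θ : Stage13HParams F 2) (hP : θ.Provisos₁₃CoPH F 2), ((θ.ZhUnity F 2 ∧ θ.SlotsNondegenerate₁₃ F 2) ∧ θ.ppSel = ppSelLiveOfRecord F 2 θ.ν θ.τ9 (EOfRecord₁₃ F 2 θ.toStage13Params) (wOfRecord₉ F 2 θ.toStage9Params)) → θ.Admissible F 2 →
      ∀ (g₀ : ℕ → ℝ) (os : List (ULoop F)),
        ∃ Wsh : ℕ → ℝ, ShellWeightBound 1 (classSet₁₃ θ K₀ g₀) (weightA₁₃ θ hP K₀ g₀ os) (weightB₁₃ θ hP K₀ g₀ os) (sh F θ hP g₀ os).1 (sh F θ hP g₀ os).2 Wsh)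
    (hlinkBareV : ∀ (F : T4Family) (θ : Stage13HParams F 2) (hP : θ.Provisos₁₃CoPH F 2), ((θ.ZhUnity F 2 ∧ θ.SlotsNondegenerate₁₃ F 2) ∧ θ.ppSel = ppSelLiveOfRecord F 2 θ.ν θ.τ9 (EOfRecord₁₃ F 2 θ.toStage13Params) (wOfRecord₉ F 2 θ.toStage9Params)) → θ.Admissible F 2 →
      ∀ (γ gIR b : ℝ) (g₀ : ℕ → ℝ), (datumOfRecord₁₃CoPH F 2 θ hP).Tuned γ gIR g₀ → γ ≤ θ.γ → γ ^ 2 ≤ Real.exp (-1) → 0 < b →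
      (∀ K m, 0 ≤ m → m < K → b ≤ (datumOfRecord₁₃CoPH F 2 θ hP).βfun m (prefixOf (runFlow (datumOfRecord₁₃CoPH F 2 θ hP) g₀ K) m)) →
      ∀ (os : List (ULoop F)) (k : ℕ),
      let S : SpineCarriers := crOfRecord₁₃VAt K₀ (jc F θ hP g₀ os) sh F θ hP g₀ os
      let R : RateCarriers 2 := rateCarriersOfRecord₁₃CoPH 𝔯 F θ hP g₀ os k
      let D : Datum F 2 := datumOfRecord₁₃CoPH F 2 θ hP
      letI := S.dec
      ∃ (_ : DecidableEq R.u3.C.Dom) (F' : Type) (ι' X' : Type) (_ : MeasurableSpace ι')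
        (L : LedgerDataSync R.u3.C F' ι' S.ι) (Rd : Readings ι' X') (bsel : (ℕ → ℝ) → ℝ) (EB : Functional R.u3.C R.u3.C.BgB)
        (g : ℕ → ℕ → ℝ)
        (uA : ℕ → ι' → R.u3.C.BgA) (uB : ℕ → ι' → R.u3.C.BgB)
        (Koff : ℕ) (cells : (K j : ℕ) → R.u3.C.Dom → Finset (Site (F.P (Koff + K)) j))
        (θ : ℝ)
        (rd : ι' → (B7Prop1Explicit.Site 4 → Fin 4 → (Matrix (Fin 2) (Fin 2) ℂ)ˣ)),
        (∀ K i, i ≤ K → g K i = runFlow D g₀ K i) ∧ (∀ K i, K < i → g K i = gIR) ∧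
        EB = (fun s => R.u3.EB (bsel s) s) ∧
        (∀ (Sz : ℕ → ℝ → S.ι → ℕ → ℝ) (E₀ : ℝ) (m : ℕ) (a : ℝ) (Cw Λg : ℝ),
          (∀ K t, |t| ≤ S.l₀ → ∀ τ ∈ S.T K \ S.Bad K t, ∀ v ∈ Rd.dom, ∀ j ≤ K,
            |∑ X ∈ L.fac K t τ with R.u3.C.scale X = j,
                (Real.log (Real.exp (EB (fun i => g (K + 1) (i + 1)) (uB K v) X
                    - EB (fun i => g (K + 1) (i + 1)) L.oneB X))
                  - Real.log (Real.exp (R.u3.EA (g K) (uA K v) X - R.u3.EA (g K) L.oneA X)))| ≤ Sz K t τ j) →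
          0 ≤ E₀ → 0 < a → a < 1 →
          (∀ K t, |t| ≤ S.l₀ → ∀ τ ∈ S.T K \ S.Bad K t, ∀ j ≤ K,
            Sz K t τ j ≤ S.vol * (E₀ * ((K : ℝ) + 1) ^ m * a ^ (K - j))) →
          (∀ K, Multiplicity (L.All K) R.u3.C.scale (fun X => Real.exp (-(R.u3.κ * R.u3.C.d X))) Cw S.vol Λg K) →
          (∀ K t, |t| ≤ S.l₀ → ∀ τ ∈ S.T K \ S.Bad K t,
            WindowMultiplicity (L.facO K t τ) L.scO L.wO Cw S.vol Λg (jlogOf L.Cl K) K) →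
          1 ≤ Λg → L.θ' ≤ Λg →
          LedgerAtSync { L with S := Sz, E₀ := E₀, m := m, a := a, Cw := Cw, Λg := Λg } S.l₀ S.vol S.T S.Bad
            (fun K t τ => S.A K t τ - S.shA K t τ) (fun K t τ => S.B K t τ - S.shB K t τ) Rd R.u3.EA EB R.u3.κ g uA uB
            R.u3.ω R.u3.ρ R.u3.θ (θ ^ ((3 : ℝ) * β - 2))) ∧
        (∀ K t, |t| ≤ S.l₀ → ∀ τ ∈ S.T K \ S.Bad K t,
          WindowMultiplicity (L.facO K t τ) L.scO L.wO L.Cw S.vol L.Λg (jlogOf L.Cl K) K) ∧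
        0 ≤ L.Cw ∧ 1 ≤ L.Λg ∧ L.θ' ≤ L.Λg ∧
        (∀ K, ∀ X ∈ L.All K,
          (cells K (R.u3.C.scale X + Koff) X).Nonempty ∧ TFaceConnected (cells K (R.u3.C.scale X + Koff) X)) ∧
        (∀ K j, Set.InjOn (cells K j) ↑((L.All K).filter fun X => R.u3.C.scale X + Koff = j)) ∧
        (∀ K, ∀ X ∈ L.All K, torusTreeLen (cells K (R.u3.C.scale X + Koff) X) ≤ R.u3.C.d X) ∧
        0 < θ ∧ θ ^ 6 = ((R.ne3.L : ℝ))⁻¹ ∧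
        (∀ v ∈ Rd.dom, rd v ∈ R.ne3.dom) ∧
        (∀ k, ∀ v ∈ Rd.dom, Rd.act k v = minAct 4 (sfClass 4 R.ne3.L R.ne3.Nper R.ne3.ε) R.ne3.L R.ne3.Nper k (rd v)) ∧
        (R.ne3.Nper : ℝ) ^ 4 ≤ Rd.vol ∧
        (∀ s ∈ Window γ, 0 < bsel s ∧ bsel s ≤ γ))
    (htarget : ∀ (F : T4Family) (θ : Stage13HParams F 2) (hP : θ.Provisos₁₃CoPH F 2), ((θ.ZhUnity F 2 ∧ θ.SlotsNondegenerate₁₃ F 2) ∧ ¬ θ.ppSel = ppSelLiveOfRecord F 2 θ.ν θ.τ9 (EOfRecord₁₃ F 2 θ.toStage13Params) (wOfRecord₉ F 2 θ.toStage9Params)) → θ.Admissible F 2 →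
        ForSmallCouplings (datumOfRecord₁₃CoPH F 2 θ hP) fun g₀ => ∀ os : List (ULoop F),
          (RatesHolderAt (datumOfRecord₁₃CoPH F 2 θ hP) (rateCarriersOfRecord₁₃CoPH 𝔯 F θ hP g₀ os (ksel F θ hP g₀ os)) β ∧
              ReadOutAt (datumOfRecord₁₃CoPH F 2 θ hP) (rateCarriersOfRecord₁₃CoPH 𝔯 F θ hP g₀ os (ksel F θ hP g₀ os)).u3 ∧
              (0 ≤ (rateCarriersOfRecord₁₃CoPH 𝔯 F θ hP g₀ os (ksel F θ hP g₀ os)).u3.ρ ∧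
                (rateCarriersOfRecord₁₃CoPH 𝔯 F θ hP g₀ os (ksel F θ hP g₀ os)).u3.ρ < 1)) →
            ∃ δ : ℕ → ℝ, Target ((F.side : ℝ) ^ 4) 1 δ (fun K => T4GenFunBounds.schemeZ ((datumOfRecord₁₃CoPH F 2 θ hP).scheme g₀) os (K₀ + K))) :
    SpineGivenEndpointR13SepCoPHV := by
  have hρ : ∀ (F : T4Family) (θ : Stage13HParams F 2), θ.Provisos₁₃CoPH F 2 → (θ.ZhUnity F 2 ∧ θ.SlotsNondegenerate₁₃ F 2) → θ.Admissible F 2 →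
      0 ≤ (ℓ F θ).ρ ∧ (ℓ F θ).ρ < 1 := fun F θ hP hG hθ => ⟨(hs F θ hP hG hθ).ρ_nonneg, (hs F θ hP hG hθ).ρ_lt_one⟩
  have h22' : ∀ (F : T4Family) (θ : Stage13HParams F 2), θ.Provisos₁₃CoPH F 2 → (θ.ZhUnity F 2 ∧ θ.SlotsNondegenerate₁₃ F 2) → θ.Admissible F 2 →
      ∀ k : ℕ, N22At (u3OfRecord₁₃ θ.toStage13Params (objectsOfRecord₁₃ F 2 θ.toStage13Params (ℓ F θ)) k) := fun F θ hP hG hθ k =>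
    n22At_u3OfRecord₁₃_of_kernelStepRate_termDataTableGermsLocatedN18AdmChartNonexpansive F 2 θ.toStage13Params (ℓ F θ) (hs F θ hP hG hθ) hθ.toStage12.toStage9.gamma_pos (hlim F θ hP hG hθ)
      (hC₅ F θ hP hG hθ) (h5 F θ hP hG hθ) (m' F θ) (M F θ) (hM F θ hP hG hθ) (𝔇 F θ) (emb F θ) (hloc F θ hP hG hθ) (sp F θ) (hsp F θ hP hG hθ) (hκh F θ hP hG hθ) (hδ₀ F θ hP hG hθ)
      (hB₃ F θ hP hG hθ) (hr F θ hP hG hθ) (hκE F θ hP hG hθ) (hκE0 F θ hP hG hθ) (hE₀ F θ hP hG hθ) (big F θ) (hbigo F θ hP hG hθ) (hrestr F θ hP hG hθ) (hbig F θ hP hG hθ) (cB F θ)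
      (hL8 F θ hP hG hθ) (hLc F θ hP hG hθ) (hκ₁ F θ hP hG hθ) (hα₆ F θ hP hG hθ) (hN F θ hP hG hθ) (hloc18 F θ hP hG hθ) (hD F θ hP hG hθ) (χu F θ) (χcu F θ) (𝒲 F θ) (𝒪 F θ) (Rt F θ)
      (Wn F θ) (hlaw F θ hP hG hθ) (hread F θ hP hG hθ) (hmaps F θ hP hG hθ) (hW F θ hP hG hθ) (hcont F θ hP hG hθ) (hjc F θ hP hG hθ) (hKb F θ hP hG hθ) (hμ F θ hP hG hθ) (hCk F θ hP hG hθ)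
      (hmk F θ hP hG hθ) (hWm F θ hP hG hθ) (hbw F θ hP hG hθ) (hbaw F θ hP hG hθ) (hι F θ hP hG hθ) (hA0 F θ hP hG hθ) (hr₁ F θ hP hG hθ) (hrate F θ hP hG hθ) (hKP F θ hP hG hθ)
      (hκr F θ hP hG hθ) (hrenew F θ hP hG hθ) (hrenewE F θ hP hG hθ) (hawcw F θ hP hG hθ) (hC1 F θ hP hG hθ) (hMb0 F θ hP hG hθ) (hϱ F θ hP hG hθ) (hR F θ hP hG hθ) (O F θ) (V F θ)
      (hcS F θ hP hG hθ) (hBq F θ hP hG hθ) (hballS F θ hP hG hθ) (hholS F θ hP hG hθ) (hbdS F θ hP hG hθ) (Ec F θ) (ι F θ) (Φ F θ) (U F θ) (hU F θ hP hG hθ) (hrU F θ hP hG hθ)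
      (hΦhol F θ hP hG hθ) (hΦemb F θ hP hG hθ) (hΦsp F θ hP hG hθ) (w F θ) (hw₀ F θ hP hG hθ) (hw F θ hP hG hθ) (htail F θ hP hG hθ) (hκ₅ F θ hP hG hθ) (hω F θ hP hG hθ) (hθω F θ hP hG hθ)
      (hℓκ F θ hP hG hθ) (hC₉ F θ hP hG hθ) k
  have h18' : ∀ (F : T4Family) (θ : Stage13HParams F 2), θ.Provisos₁₃CoPH F 2 → (θ.ZhUnity F 2 ∧ θ.SlotsNondegenerate₁₃ F 2) → θ.Admissible F 2 →
      ∀ k : ℕ, N18At (u3OfRecord₁₃ θ.toStage13Params (objectsOfRecord₁₃ F 2 θ.toStage13Params (ℓ F θ)) k) := fun F θ hP hG hθ k =>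
    n18At_u3OfRecord₁₃_objectsOfRecord₁₃_of_kernelStepRateOfRecord₁₃ F 2 θ.toStage13Params (ℓ F θ) k
      (kernelStepRateOfRecord₁₃_mono F 2 θ.toStage13Params (h5 F θ hP hG hθ) ((hℓκ F θ hP hG hθ).trans (hκ₅ F θ hP hG hθ)) (hs F θ hP hG hθ).θ₅_pos.le le_rfl
        (hC₅ℓ F θ hP hG hθ) (hs F θ hP hG hθ).C₅_nonneg)
  exact fun F θ h v hG hθ _ _ =>
    hybridNE7Under_of_forSmallCouplings_stringwise (Node00.datumOfRecord₁₃SepCoPHV F 2 θ h v)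
      (show ForSmallCouplings (Node00.datumOfRecord₁₃SepCoPHV F 2 θ h v) (fun g₀ => StringwiseHybridNE7 ((Node00.datumOfRecord₁₃SepCoPHV F 2 θ h v).scheme g₀)) from
        bodyBFree₁₃CoPH_of_split (fun F (θ : Stage13HParams F 2) => (θ.ZhUnity F 2 ∧ θ.SlotsNondegenerate₁₃ F 2)) (fun F (θ : Stage13HParams F 2) => θ.ppSel = ppSelLiveOfRecord F 2 θ.ν θ.τ9 (EOfRecord₁₃ F 2 θ.toStage13Params) (wOfRecord₉ F 2 θ.toStage9Params))
          (bodyBFree₁₃CoPH_of_v5pins_bareLedgerReadingV_kernelFaces_at_crOfRecord₁₃VAt_cut K₀ jc sh β 𝔯 ℓ ℓ₃ g B c'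
          (fun F (θ : Stage13HParams F 2) => (θ.ZhUnity F 2 ∧ θ.SlotsNondegenerate₁₃ F 2) ∧ θ.ppSel = ppSelLiveOfRecord F 2 θ.ν θ.τ9 (EOfRecord₁₃ F 2 θ.toStage13Params) (wOfRecord₉ F 2 θ.toStage9Params))
          ksel hpin1 hpin2 hpinL hpin (fun F hF => h16 F (hF.elim fun θ h => ⟨θ, h.1, h.2.1.1, h.2.2⟩)) (fun F θ hP hRg hθ => hs F θ hP hRg.1 hθ) (fun F θ hP hRg hθ => hκ F θ hP hRg.1 hθ)
          (fun F θ hP hRg hθ => hcr F θ hP hRg.1 hθ) (fun F θ hP hRg hθ => hκ₀ F θ hP hRg.1 hθ) (fun μ ν F θ hP hRg hθ => hK μ ν F θ hP hRg.1 hθ) (fun F θ hP hRg hθ => h18' F θ hP hRg.1 hθ)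
          (fun F θ hP hRg hθ => h22' F θ hP hRg.1 hθ) hβ23 hβ1 hmatch hend hradii hclass hH3 hsel3
          (fun F θ hP hRg hθ => hβw F θ hP hRg.1 hθ) (fun _ _ _ hRg _ => ⟨_, hRg.2⟩) hζm h20 h21 hlinkBareV)
          (bodyBFree₁₃CoPH_of_kernels_pin_bFree (crOneTerm₁₃ K₀) 𝔯 ksel (fun {F} (θ : Stage13HParams F 2) => ((θ.ZhUnity F 2 ∧ θ.SlotsNondegenerate₁₃ F 2) ∧ ¬ θ.ppSel = ppSelLiveOfRecord F 2 θ.ν θ.τ9 (EOfRecord₁₃ F 2 θ.toStage13Params) (wOfRecord₉ F 2 θ.toStage9Params))) ℓ β hpin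
            (fun F θ hP hRg hθ => ForSmallCouplings.of_forall fun g₀ os => by
              refine ⟨?_, ?_, ?_⟩
              · exact n14At_rateCarriersOfRecord₁₃CoPH_of_pinned 𝔯 hpin1 F θ hP g₀ os (ksel F θ hP g₀ os)
              · obtain ⟨b, aS, ν, μ, α, β', c35, p, hb, haS, h⟩ := hpin2
                rw [h F θ hP g₀ os]
                exact n15At_fullGSizedObjects_family hb haS ν μ α β' c35 p F
              · show N16HolderAt (rateCarriersOfRecord₁₃CoPH 𝔯 F θ hP g₀ os (ksel F θ hP g₀ os)).ne3 β
                rw [rateCarriers_ne3_of_pinnedLoose hpinL F θ hP g₀ os (ksel F θ hP g₀ os)]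
                exact h16 F ⟨θ, hP, hRg.1, hθ⟩)
            (fun F θ hP hRg hθ => hs F θ hP hRg.1 hθ) (fun F θ hP hRg hθ => hκ F θ hP hRg.1 hθ) (fun F θ hP hRg hθ => hcr F θ hP hRg.1 hθ)
            (fun F θ hP hRg hθ => hρ F θ hP hRg.1 hθ) (h20_shape_crOneTerm₁₃ K₀) (h21_shape_crOneTerm₁₃ K₀)
            (fun F θ hP hRg hθ => (htarget F θ hP hRg hθ).mono fun g₀ hg os hPr =>
              (core_crOneTerm₁₃_iff_target K₀ θ hP g₀ os).2 (hg os hPr))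
            (fun _ θ hP _ _ => ForSmallCouplings.of_forall fun g₀ os => extraction_crOneTerm₁₃ K₀ θ hP g₀ os)
            (fun F θ hP hRg hθ => hK 0 1 F θ hP hRg.1 hθ) (fun F θ hP hRg hθ => h18' F θ hP hRg.1 hθ)
            (fun F θ hP hRg hθ => h22' F θ hP hRg.1 hθ))
          F θ h.toCore hG hθ) _

end Summit.QuantumFields.YangMills.Theorems.BalabanUVNodesN27SpineRecord
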